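import Summits.AtomisticToContinuum.HydrodynamicLimit.Theorems.CorrectorPressureDecay.Negative.Statics
import Summits.AtomisticToContinuum.HydrodynamicLimit.Theorems.CorrectorPressureDecay.Negative.MazurFloor

/-!
# `CorrectorPressureDecay` — negative knowledge (c.2): the lag must be SHORTER than the cost window

Support file for crux `stmt-AtomisticToContinuum-14135` (`AntiMazurCoboundaries.CorrectorPressureDecay`, "X"),
written by the standing disprover (cdisprove seat, cycle 2). A natural strengthening of X is refuted, for EVERY
fixed ratio `c > 0`: asking the corrector's lag to be at least `c` cost windows, `c·h₀ ≤ lag`, `h₀ = τ₀ (N+1)^{-1/3}`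
(e.g. "lag = the certificate window"), is FALSE — for every flow, every corrector and every `N`. This is the "lag
rigidity" of the crux NOTES (S3) as a theorem: every witness of X at tolerance `δ` satisfies
`log E_γ exp((2 lag/(lag + h₀)) g) ≤ δ`, i.e. `lag ≲ h₀ √δ / s_g` — the lag is asymptotically SHORTER than the cost
window as `δ → 0`.

Mechanism (three Gibbs inequalities, `tilted_jensen`, under the law `Q = G_N` tilted by `ε₀ F`, `F = Σᵢ g(vᵢ)`,
`ε₀ = 2c/(1+c)`; write `z = log ∫e^{ε₀F} dG_N = (N+1) log E_γ e^{ε₀ g}`, `f = E_Q F`, `α = E_Q[W∘Φ_lag]/lag`,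
`β = E_Q[W]/lag`): defect clause ⟹ `z + (2−ε₀)f − 2α + 2β ≤ δ(N+1)`; cost clause + invariance of `G_N` +
`4c/lag ≤ 4/h₀` ⟹ `z + 4cα − ε₀f ≤ δ(N+1)` and `z − 4cβ − ε₀f ≤ δ(N+1)`; the combination with weights `(2c, 1, 1)`
cancels `α, β` AND `f` (`2c(2−ε₀) = 2ε₀`), leaving `z ≤ δ(N+1)`, i.e. `δ ≥ log E_γ e^{ε₀ g} > 0` — false for
`δ = ½ log E_γ e^{ε₀ g}` with the admissible witness `g = gW κ`.

* `lagRigidity` — the INEQUALITY, for provers: any `(lag, W, h₀)` satisfying the two clauses for `F = Σ g(vᵢ)`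
  (`g` merely bounded measurable; `a = θ = 1`, `u₀ = 0`) has `log E_γ exp((2lag/(lag+h₀)) g) ≤ δ`;
* `CorrectorPressureDecayLagGeWindow c` — X with the conjunct `c · τ₀ (N+1)^{-1/3} ≤ lag` added (a variant statement
  refuted below for every `c > 0`, not a fact; it trivially implies X);
* `correctorPressureDecay_false_lagGeWindow : 0 < c → ¬ CorrectorPressureDecayLagGeWindow c`.

Reading for provers: the two clauses of X pull in opposite directions — the cost clause caps `|W| ≲ δ h₀ (N+1)`
while cancelling `F` needs `|W∘Φ_lag − W| ≈ lag·|F| ≈ lag κ (N+1)`; only `lag ≪ h₀` (the route's fixed kinetic lag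
`λℓ` against `h₀ = τ₀ℓ`, `τ₀ ≥ 2κT/δ`) is consistent. All `[folklore]`.
-/

noncomputable section

open MeasureTheory ProbabilityTheory Set Filter Topology
open scoped ENNReal

namespace Summit.AtomisticToContinuum.HydrodynamicLimit.Theorems.CorrectorPressureDecayNegative.LagWindow

open Literature.MathematicalPhysics.KineticTheory (T3 V3 hsDiameter localGibbsLaw localGibbsMeasure
  localGibbsProfile localGibbsLaw_eq isProbabilityMeasure_localGibbsLaw)
open Literature.Analysis.FluidPDE (HardSphereFlow Config)
open Summit.AtomisticToContinuum.HydrodynamicLimit.Theorems.CellForecastPressureDecay (gW continuous_gW abs_gW_le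
  gW_orthogonal one_lt_integral_exp_gW)
open Statics (integrable_exp_mul_gW)

/-- Hard-sphere flows of `N + 1` spheres of reduced diameter `σ` on `𝕋³` (the crux's `Φ`). -/
abbrev Flow (σ : ℝ) (N : ℕ) : Type :=
  HardSphereFlow (Literature.Analysis.FluidPDE.Torus.geometry (Fin 3)) (hsDiameter σ N) (N + 1)

/-- Phase space of `N + 1` spheres on `𝕋³`. -/
abbrev Phase (N : ℕ) : Type := Config (N + 1) (Fin 3) T3

/-- `CorrectorPressureDecay` STRENGTHENED by the conjunct `c · h₀ ≤ lag` (`h₀ = τ₀ (N+1)^{-1/3}`, the cost scale;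
`c` a fixed ratio): the corrector's lag is at least `c` certificate windows. All other tokens verbatim. A variant
statement refuted below for EVERY `c > 0`, not a fact. -/
def CorrectorPressureDecayLagGeWindow (c : ℝ) : Prop :=
  ∀ (a θ : ℝ) (u₀ : V3), 0 < a → 0 < θ → ∃ σ₀ : ℝ, 0 < σ₀ ∧ ∀ σ : ℝ, 0 < σ → σ < σ₀ →
    (∀ (N : ℕ) (Φ : Flow σ N),
      IsProbabilityMeasure (localGibbsLaw σ (fun _ => a) (fun _ => u₀) (fun _ => θ) N Φ)) ∧
    ∃ κ : ℝ, 0 < κ ∧ ∀ (φ : T3 → ℝ) (g : V3 → ℝ), Continuous φ → Continuous g → (∀ x, |φ x| ≤ 1) →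
      (∀ v, |g v| ≤ κ) →
      (∀ (c₀ c₂ : ℝ) (b : V3), ∫ v, g v * (c₀ + inner ℝ b v + c₂ * ‖v‖ ^ 2) ∂stdGaussian V3 = 0) →
      ∀ δ : ℝ, 0 < δ → ∃ τ₀ : ℝ, 0 < τ₀ ∧ ∃ N₀ : ℕ, ∀ N : ℕ, N₀ ≤ N → ∀ Φ : Flow σ N,
        ∃ lag : ℝ, 0 < lag ∧ c * (τ₀ * ((N + 1 : ℕ) : ℝ) ^ (-(1 / 3 : ℝ))) ≤ lag ∧
          ∃ W : Phase N → ℝ, Measurable W ∧ (∃ C : ℝ, ∀ z, |W z| ≤ C) ∧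
          ∫⁻ z, ENNReal.ofReal (Real.exp (2 * ((∑ i, φ (z i).1 * g ((Real.sqrt θ)⁻¹ • ((z i).2 - u₀))) -
              lag⁻¹ * (W (Φ.flow lag z) - W z))))
            ∂(localGibbsLaw σ (fun _ => a) (fun _ => u₀) (fun _ => θ) N Φ) ≤
            ENNReal.ofReal (Real.exp (δ * (N + 1))) ∧
          ∫⁻ z, ENNReal.ofReal (Real.exp (4 * (τ₀ * ((N + 1 : ℕ) : ℝ) ^ (-(1 / 3 : ℝ)))⁻¹ * |W z|))
            ∂(localGibbsLaw σ (fun _ => a) (fun _ => u₀) (fun _ => θ) N Φ) ≤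
            ENNReal.ofReal (Real.exp (δ * (N + 1)))

/-- From `∫⁻ ofReal (exp Y) ≤ ofReal (exp b)` to the Bochner inequality `∫ exp Y ≤ exp b` for bounded measurable
`Y` on a finite measure space. [folklore] -/
theorem integral_exp_le_of_lintegral_le {X : Type*} [MeasurableSpace X] {μ : Measure X} [IsFiniteMeasure μ]
    {Y : X → ℝ} (hYm : Measurable Y) {C : ℝ} (hY : ∀ x, |Y x| ≤ C) {b : ℝ}
    (h : ∫⁻ x, ENNReal.ofReal (Real.exp (Y x)) ∂μ ≤ ENNReal.ofReal (Real.exp b)) :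
    ∫ x, Real.exp (Y x) ∂μ ≤ Real.exp b := by
  rw [← ofReal_integral_eq_lintegral_ofReal (integrable_exp_of_abs_le hYm hY)
    (ae_of_all _ fun _ => (Real.exp_pos _).le), ENNReal.ofReal_le_ofReal_iff (Real.exp_pos _).le] at h
  exact h

/-- **LAG RIGIDITY (the inequality).** In the crux's frame with `a = θ = 1`, `u₀ = 0`, `φ ≡ 1` and ANY bounded
measurable one-body `g` (no orthogonality or amplitude needed): if a lag `lag > 0`, a bounded measurable corrector `W`
and a cost scale `h₀ > 0` satisfy the crux's two clauses at tolerance `δ` — defect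
`∫ exp(2(Σᵢ g(vᵢ) − lag⁻¹(W∘Φ_lag − W))) dG_N ≤ e^{δ(N+1)}` and cost `∫ exp(4h₀⁻¹|W|) dG_N ≤ e^{δ(N+1)}` — then
`log E_γ exp((2·lag/(lag + h₀))·g) ≤ δ`. Proof: three Gibbs inequalities (`tilted_jensen`) under `G_N` tilted by
`ε₀ Σ g(vᵢ)`, `ε₀ = 2lag/(lag+h₀)`: the defect clause; the cost clause tested with `(4/h₀)·W∘Φ_lag` (invariance of
`G_N`); the cost clause with `−(4/h₀)·W`; the weights `(2lag/h₀, 1, 1)` cancel the corrector terms AND the tilted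
mean of `Σg` exactly, and the product formula `∫e^{ε₀Σg}dG_N = (E_γe^{ε₀g})^{N+1}` leaves the claim. For `g ⊥ 1`
with `s² = E_γ g²` this reads `lag/(lag+h₀) ≲ √δ/s`: the lag of any witness is asymptotically SHORTER than the cost
window. [folklore] -/
theorem lagRigidity {σ : ℝ} (hσ2 : σ ≤ 1 / 2) {N : ℕ} (Φ : Flow σ N)
    (hprob : IsProbabilityMeasure (localGibbsLaw σ (fun _ => (1 : ℝ)) (fun _ => (0 : V3)) (fun _ => (1 : ℝ)) N Φ))
    {g : V3 → ℝ} (hgm : Measurable g) {K : ℝ} (hgK : ∀ v, |g v| ≤ K) {δ h₀ lag : ℝ} (hh₀ : 0 < h₀)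
    (hlag : 0 < lag) {W : Phase N → ℝ} (hWm : Measurable W) {CW : ℝ} (hW : ∀ z, |W z| ≤ CW)
    (h1 : ∫⁻ z, ENNReal.ofReal (Real.exp (2 * ((∑ i, g (z i).2) - lag⁻¹ * (W (Φ.flow lag z) - W z))))
      ∂(localGibbsLaw σ (fun _ => (1 : ℝ)) (fun _ => (0 : V3)) (fun _ => (1 : ℝ)) N Φ) ≤
      ENNReal.ofReal (Real.exp (δ * (N + 1))))
    (h2 : ∫⁻ z, ENNReal.ofReal (Real.exp (4 * h₀⁻¹ * |W z|))
      ∂(localGibbsLaw σ (fun _ => (1 : ℝ)) (fun _ => (0 : V3)) (fun _ => (1 : ℝ)) N Φ) ≤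
      ENNReal.ofReal (Real.exp (δ * (N + 1)))) :
    Real.log (∫ v, Real.exp (2 * lag / (lag + h₀) * g v) ∂stdGaussian V3) ≤ δ := by
  haveI := hprob
  set G := localGibbsLaw σ (fun _ => (1 : ℝ)) (fun _ => (0 : V3)) (fun _ => (1 : ℝ)) N Φ with hGdef
  set c : ℝ := lag / h₀ with hc
  have hcpos : 0 < c := by positivity
  set ε₀ : ℝ := 2 * lag / (lag + h₀) with hε₀
  have hε₀pos : 0 < ε₀ := by positivity
  have hε₀c : ε₀ * (1 + c) = 2 * c := by
    rw [hε₀, hc]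
    field_simp
    ring
  set M : ℝ := ∫ v, Real.exp (ε₀ * g v) ∂stdGaussian V3 with hM
  have hexpg : Integrable (fun v => Real.exp (ε₀ * g v)) (stdGaussian V3) :=
    integrable_exp_of_abs_le (hgm.const_mul ε₀) (C := ε₀ * K) fun v => by
      rw [abs_mul, abs_of_pos hε₀pos]; exact mul_le_mul_of_nonneg_left (hgK v) hε₀pos.le
  have hMpos : 0 < M := by rw [hM]; exact integral_exp_pos hexpg
  -- the one-body sum `F = Σ g(vᵢ)` and the tilt potential `V = ε₀ F`
  set F : Phase N → ℝ := fun z => ∑ i, g (z i).2 with hF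
  set V : Phase N → ℝ := fun z => ∑ i, ε₀ * g (z i).2 with hV
  have hVF : ∀ z, V z = ε₀ * F z := fun z => by simp only [hV, hF, Finset.mul_sum]
  have hFm : Measurable F := Finset.measurable_sum _ fun i _ => hgm.comp (measurable_pi_apply i).snd
  have hVm : Measurable V := Finset.measurable_sum _ fun i _ => (hgm.comp (measurable_pi_apply i).snd).const_mul ε₀
  have hK0 : 0 ≤ K := (abs_nonneg _).trans (hgK 0)
  have hFb : ∀ z, |F z| ≤ ∑ _i : Fin (N + 1), K := fun z =>
    (Finset.abs_sum_le_sum_abs _ _).trans (Finset.sum_le_sum fun i _ => hgK _)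
  have hVb : ∀ z, |V z| ≤ ε₀ * ∑ _i : Fin (N + 1), K := fun z => by
    rw [hVF, abs_mul, abs_of_pos hε₀pos]
    exact mul_le_mul_of_nonneg_left (hFb z) hε₀pos.le
  have hT : MeasurePreserving (Φ.flow lag) G G := measurePreserving_flow_localGibbsLaw 1 1 N Φ lag
  have hWΦm : Measurable fun z => W (Φ.flow lag z) := hWm.comp (Φ.measurable_flow lag)
  have hWΦ : ∀ z, |W (Φ.flow lag z)| ≤ CW := fun z => hW _
  -- (i) the defect clause as a Bochner inequality for `Y₁ = 2F − 2 lag⁻¹ (W∘Φ − W)`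
  set Y₁ : Phase N → ℝ := fun z => 2 * F z - 2 * lag⁻¹ * (W (Φ.flow lag z) - W z) with hY₁
  have hrw1 : ∀ z : Phase N, Real.exp (2 * ((∑ i, g (z i).2) - lag⁻¹ * (W (Φ.flow lag z) - W z))) =
      Real.exp (Y₁ z) := by
    intro z
    simp only [hY₁, hF]
    congr 1
    ring
  simp_rw [hrw1] at h1
  have hY₁m : Measurable Y₁ := (hFm.const_mul 2).sub (measurable_const.mul (hWΦm.sub hWm))
  have hY₁b : ∀ z, |Y₁ z| ≤ 2 * (∑ _i : Fin (N + 1), K) + |2 * lag⁻¹| * (CW + CW) := by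
    intro z
    calc |Y₁ z| ≤ |2 * F z| + |2 * lag⁻¹ * (W (Φ.flow lag z) - W z)| := abs_sub _ _
      _ = 2 * |F z| + |2 * lag⁻¹| * |W (Φ.flow lag z) - W z| := by
          rw [abs_mul 2 (F z), abs_mul (2 * lag⁻¹) (W (Φ.flow lag z) - W z), abs_two]
      _ ≤ _ := by
          gcongr
          · exact hFb z
          · exact (abs_sub _ _).trans (add_le_add (hW _) (hW _))
  have hI1 : ∫ z, Real.exp (Y₁ z) ∂G ≤ Real.exp (δ * (N + 1)) := integral_exp_le_of_lintegral_le hY₁m hY₁b h1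
  -- (ii) the cost clause as a Bochner inequality, then for `Y₂ = (4/h₀) W∘Φ` and `Y₃ = −(4/h₀) W`
  set a : ℝ := 4 * h₀⁻¹ with ha
  have hapos : 0 < a := by positivity
  have hcostm : Measurable fun z => a * |W z| := measurable_const.mul hWm.abs
  have hcostb : ∀ z, abs (a * |W z|) ≤ a * CW := by
    intro z
    rw [abs_mul, abs_abs, abs_of_pos hapos]
    exact mul_le_mul_of_nonneg_left (hW z) hapos.le
  have hI0 : ∫ z, Real.exp (a * |W z|) ∂G ≤ Real.exp (δ * (N + 1)) :=
    integral_exp_le_of_lintegral_le hcostm hcostb h2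
  have hcostint : Integrable (fun z => Real.exp (a * |W z|)) G := integrable_exp_of_abs_le hcostm hcostb
  set Y₂ : Phase N → ℝ := fun z => a * W (Φ.flow lag z) with hY₂
  set Y₃ : Phase N → ℝ := fun z => -(a * W z) with hY₃
  have hY₂m : Measurable Y₂ := measurable_const.mul hWΦm
  have hY₃m : Measurable Y₃ := (measurable_const.mul hWm).neg
  have hY₂b : ∀ z, |Y₂ z| ≤ a * CW := by
    intro z
    rw [hY₂, abs_mul, abs_of_pos hapos]
    exact mul_le_mul_of_nonneg_left (hW _) hapos.le
  have hY₃b : ∀ z, |Y₃ z| ≤ a * CW := by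
    intro z
    rw [hY₃, abs_neg, abs_mul, abs_of_pos hapos]
    exact mul_le_mul_of_nonneg_left (hW _) hapos.le
  have hptw : ∀ w : ℝ, a * w ≤ a * |w| := fun w => mul_le_mul_of_nonneg_left (le_abs_self w) hapos.le
  have hI2 : ∫ z, Real.exp (Y₂ z) ∂G ≤ Real.exp (δ * (N + 1)) := by
    have hcomp : ∫ z, Real.exp (Y₂ z) ∂G = ∫ z, Real.exp (a * W z) ∂G := by
      have hgm' : AEStronglyMeasurable (fun z => Real.exp (a * W z)) (Measure.map (Φ.flow lag) G) :=
        (Real.continuous_exp.measurable.comp (measurable_const.mul hWm)).aestronglyMeasurable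
      have him := integral_map (μ := G) (hT.measurable.aemeasurable) hgm'
      rw [hT.map_eq] at him
      simp only [hY₂]
      exact him.symm
    rw [hcomp]
    have hb4 : ∀ z, |a * W z| ≤ a * CW := by
      intro z
      rw [abs_mul, abs_of_pos hapos]
      exact mul_le_mul_of_nonneg_left (hW _) hapos.le
    exact (integral_mono (integrable_exp_of_abs_le (measurable_const.mul hWm) hb4) hcostint
      fun z => Real.exp_le_exp.2 (hptw (W z))).trans hI0
  have hI3 : ∫ z, Real.exp (Y₃ z) ∂G ≤ Real.exp (δ * (N + 1)) := by
    refine (integral_mono (integrable_exp_of_abs_le hY₃m hY₃b) hcostint fun z => Real.exp_le_exp.2 ?_).trans hI0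
    simp only [hY₃]
    have := hptw (-W z)
    rwa [abs_neg, mul_neg] at this
  -- the three Gibbs inequalities under `Q = G.tilted V`
  set Z : ℝ := ∫ z, Real.exp (V z) ∂G with hZ
  have hJ1 := tilted_jensen (μ := G) hVm hY₁m hVb hY₁b
  have hJ2 := tilted_jensen (μ := G) hVm hY₂m hVb hY₂b
  have hJ3 := tilted_jensen (μ := G) hVm hY₃m hVb hY₃b
  -- the static value `Z = M^{N+1}`, so `log Z = (N+1) log M`
  have hZval : Z = M ^ (N + 1) := by
    have hl : ∫⁻ z, ENNReal.ofReal (Real.exp (V z)) ∂G = (ENNReal.ofReal M) ^ (N + 1) := by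
      simp only [hV]
      rw [hGdef, localGibbsLaw_eq, lintegral_exp_sum_vel_localGibbsMeasure one_pos one_pos 0 hσ2 N
        (hgm.const_mul ε₀), gaussMeasure_zero_one, hM]
      congr 1
      rw [← ofReal_integral_eq_lintegral_ofReal hexpg (ae_of_all _ fun _ => (Real.exp_pos _).le)]
    have hVint : Integrable (fun z => Real.exp (V z)) G := integrable_exp_of_abs_le hVm hVb
    have h' : ENNReal.ofReal Z = ENNReal.ofReal (M ^ (N + 1)) := by
      rw [hZ, ofReal_integral_eq_lintegral_ofReal hVint (ae_of_all _ fun _ => (Real.exp_pos _).le), hl,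
        ENNReal.ofReal_pow hMpos.le]
    have hZnn : 0 ≤ Z := integral_nonneg fun _ => (Real.exp_pos _).le
    exact (ENNReal.ofReal_eq_ofReal_iff hZnn (by positivity)).1 h'
  have hlogZ : Real.log Z = (N + 1 : ℝ) * Real.log M := by
    rw [hZval, Real.log_pow]
    push_cast
    ring
  have hZpos : 0 < Z := by rw [hZval]; positivity
  -- take logs: `log Z + mₖ ≤ δ (N+1)`
  have hlog : ∀ {m b : ℝ} {I : ℝ}, Z * Real.exp m ≤ I → I ≤ Real.exp b → Real.log Z + m ≤ b := by
    intro m b I hle hIb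
    have hpos : 0 < Z * Real.exp m := mul_pos hZpos (Real.exp_pos _)
    have := Real.log_le_log hpos (hle.trans hIb)
    rwa [Real.log_mul hZpos.ne' (Real.exp_pos _).ne', Real.log_exp, Real.log_exp] at this
  have hL1 := hlog hJ1 hI1
  have hL2 := hlog hJ2 hI2
  have hL3 := hlog hJ3 hI3
  -- evaluate the tilted means by linearity
  haveI : IsProbabilityMeasure (G.tilted V) := isProbabilityMeasure_tilted (integrable_exp_of_abs_le hVm hVb)
  set Q := G.tilted V with hQ
  have hFi : Integrable F Q := integrable_of_abs_le hFm hFb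
  have hWi : Integrable W Q := integrable_of_abs_le hWm hW
  have hWΦi : Integrable (fun z => W (Φ.flow lag z)) Q := integrable_of_abs_le hWΦm hWΦ
  set f : ℝ := ∫ z, F z ∂Q with hf
  set A : ℝ := ∫ z, W (Φ.flow lag z) ∂Q with hA
  set B : ℝ := ∫ z, W z ∂Q with hB
  have hm1 : ∫ z, (Y₁ z - V z) ∂Q = (2 - ε₀) * f - 2 * lag⁻¹ * (A - B) := by
    have e : (fun z => Y₁ z - V z) = fun z => (2 - ε₀) * F z - 2 * lag⁻¹ * (W (Φ.flow lag z) - W z) := by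
      funext z; simp only [hY₁]; rw [hVF]; ring
    have hD : Integrable (fun z => W (Φ.flow lag z) - W z) Q := hWΦi.sub hWi
    have hcD : Integrable (fun z => 2 * lag⁻¹ * (W (Φ.flow lag z) - W z)) Q := hD.const_mul (2 * lag⁻¹)
    have hcF : Integrable (fun z => (2 - ε₀) * F z) Q := hFi.const_mul (2 - ε₀)
    rw [e, integral_sub hcF hcD, integral_const_mul, integral_const_mul, integral_sub hWΦi hWi]
  have hm2 : ∫ z, (Y₂ z - V z) ∂Q = a * A - ε₀ * f := by
    have e : (fun z => Y₂ z - V z) = fun z => a * W (Φ.flow lag z) - ε₀ * F z := by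
      funext z; simp only [hY₂]; rw [hVF]
    have hc2 : Integrable (fun z => a * W (Φ.flow lag z)) Q := hWΦi.const_mul a
    have hcF : Integrable (fun z => ε₀ * F z) Q := hFi.const_mul ε₀
    rw [e, integral_sub hc2 hcF, integral_const_mul, integral_const_mul]
  have hm3 : ∫ z, (Y₃ z - V z) ∂Q = -(a * B) - ε₀ * f := by
    have e : (fun z => Y₃ z - V z) = fun z => -(a * W z) - ε₀ * F z := by
      funext z; simp only [hY₃]; rw [hVF]
    have hc3 : Integrable (fun z => -(a * W z)) Q := (hWi.const_mul a).neg
    have hcF : Integrable (fun z => ε₀ * F z) Q := hFi.const_mul ε₀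
    rw [e, integral_sub hc3 hcF, integral_neg, integral_const_mul, integral_const_mul]
  rw [hm1, hlogZ] at hL1
  rw [hm2, hlogZ] at hL2
  rw [hm3, hlogZ] at hL3
  -- linear bookkeeping with weights (2c, 1, 1), `c = lag/h₀` (so `a = 4c/lag`): corrector terms and `f` cancel
  set P : ℝ := (N + 1 : ℝ) * Real.log M with hPdef
  set α : ℝ := lag⁻¹ * A with hα
  set β : ℝ := lag⁻¹ * B with hβ
  have hac : a = 4 * c * lag⁻¹ := by rw [ha, hc]; field_simp
  have e1 : P + ((2 - ε₀) * f - 2 * α + 2 * β) ≤ δ * (N + 1) := by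
    have : (2 - ε₀) * f - 2 * lag⁻¹ * (A - B) = (2 - ε₀) * f - 2 * α + 2 * β := by rw [hα, hβ]; ring
    linarith [hL1, this]
  have e2 : P + (4 * c * α - ε₀ * f) ≤ δ * (N + 1) := by
    have : a * A - ε₀ * f = 4 * c * α - ε₀ * f := by rw [hac, hα]; ring
    linarith [hL2, this]
  have e3 : P + (-(4 * c * β) - ε₀ * f) ≤ δ * (N + 1) := by
    have : -(a * B) - ε₀ * f = -(4 * c * β) - ε₀ * f := by rw [hac, hβ]; ring
    linarith [hL3, this]
  have e1' : 2 * c * (P + ((2 - ε₀) * f - 2 * α + 2 * β)) ≤ 2 * c * (δ * (N + 1)) :=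
    mul_le_mul_of_nonneg_left e1 (by positivity)
  have hx : 2 * c * (P + ((2 - ε₀) * f - 2 * α + 2 * β)) + (P + (4 * c * α - ε₀ * f)) +
      (P + (-(4 * c * β) - ε₀ * f)) = (2 * c + 2) * P + (2 * c * (2 - ε₀) - 2 * ε₀) * f := by ring
  have hy : 2 * c * (δ * (N + 1)) + δ * (N + 1) + δ * (N + 1) = (2 * c + 2) * (δ * (N + 1)) := by ring
  have hcoef : 2 * c * (2 - ε₀) - 2 * ε₀ = 0 := by linear_combination (-2) * hε₀c
  have hsum := add_le_add (add_le_add e1' e2) e3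
  rw [hx, hy, hcoef, zero_mul, add_zero] at hsum
  -- divide by `(2c + 2)(N + 1) > 0`
  have hk : 0 < 2 * c + 2 := by positivity
  have hP' : P ≤ δ * (N + 1) := le_of_mul_le_mul_left (by linarith [hsum]) hk
  have hn : (0 : ℝ) < N + 1 := by positivity
  rw [hPdef] at hP'
  have := (mul_comm _ _).trans_le hP'  -- Real.log M * (N+1) ≤ δ * (N+1)
  exact le_of_mul_le_mul_right this hn

/-- **`c·h₀ ≤ lag` is impossible, for every fixed ratio `c > 0`: X so strengthened is FALSE.** Witness
`a = θ = 1`, `u₀ = 0`, `σ = min(σ₀/2, 1/4)`, `φ ≡ 1`, `g = gW κ` (the prover's own `κ`), `ε₀ = 2c/(1+c)`,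
`δ = ½ log E_γ e^{ε₀ g}`, `N = N₀`, any flow (flows exist: Alexander). Apply `lagRigidity` at the LONGER cost scale
`h₀' = lag/c ≥ h₀` (the cost clause is monotone in the scale), where `2lag/(lag + h₀') = ε₀`:
`log E_γ e^{ε₀ g} ≤ δ = ½ log E_γ e^{ε₀ g}`, contradicting `E_γ e^{ε₀ g} > 1`. [folklore] -/
theorem correctorPressureDecay_false_lagGeWindow {c : ℝ} (hc : 0 < c) : ¬ CorrectorPressureDecayLagGeWindow c := by
  intro h
  obtain ⟨σ₀, hσ₀, hσ⟩ := h 1 1 0 one_pos one_pos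
  set σ : ℝ := min (σ₀ / 2) 4⁻¹ with hσdef
  have hσpos : 0 < σ := lt_min (by linarith) (by norm_num)
  have hσlt : σ < σ₀ := (min_le_left _ _).trans_lt (by linarith)
  have hσ2 : σ ≤ 1 / 2 := (min_le_right _ _).trans (by norm_num)
  have hσ2' : σ < 2⁻¹ := (min_le_right _ _).trans_lt (by norm_num)
  obtain ⟨hprob, κ, hκ, hmain⟩ := hσ σ hσpos hσlt
  set ε₀ : ℝ := 2 * c / (1 + c) with hε₀
  have hε₀pos : 0 < ε₀ := by positivity
  set M : ℝ := ∫ v, Real.exp (ε₀ * gW κ v) ∂stdGaussian V3 with hM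
  have hgg : ∀ w : V3, ε₀ * gW κ w = 2 * gW (ε₀ * κ / 2) w := by
    intro w
    simp only [gW]
    ring
  have hM1 : 1 < M := by
    rw [hM]
    simp_rw [hgg]
    exact one_lt_integral_exp_gW (by positivity : ε₀ * κ / 2 ≠ 0)
  set Λ : ℝ := Real.log M with hΛ
  have hΛpos : 0 < Λ := Real.log_pos hM1
  set δ : ℝ := Λ / 2 with hδ
  have hδpos : 0 < δ := by positivity
  obtain ⟨τ₀, hτ₀, N₀, hN⟩ := hmain (fun _ => 1) (gW κ) continuous_const (continuous_gW κ) (fun _ => by simp)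
    (abs_gW_le hκ.le) (gW_orthogonal κ) δ hδpos
  obtain ⟨Φ⟩ := nonempty_flow hσpos hσ2' N₀
  obtain ⟨lag, hlag, hlagge, W, hWm, ⟨CW, hW⟩, h1, h2⟩ := hN N₀ le_rfl Φ
  haveI := hprob N₀ Φ
  set G := localGibbsLaw σ (fun _ => (1 : ℝ)) (fun _ => (0 : V3)) (fun _ => (1 : ℝ)) N₀ Φ with hGdef
  set h₀ : ℝ := τ₀ * ((N₀ + 1 : ℕ) : ℝ) ^ (-(1 / 3 : ℝ)) with hh₀
  have hh₀pos : 0 < h₀ := mul_pos hτ₀ (Real.rpow_pos_of_pos (by positivity) _)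
  -- the longer cost scale `h₀' = lag / c ≥ h₀`
  set h₀' : ℝ := lag / c with hh₀'
  have hh₀'pos : 0 < h₀' := by positivity
  have hle : h₀ ≤ h₀' := by rw [hh₀', le_div_iff₀ hc, mul_comm]; exact hlagge
  have hrw1 : ∀ z : Phase N₀, Real.exp (2 * ((∑ i, (fun _ : T3 => (1 : ℝ)) (z i).1 *
      gW κ ((Real.sqrt 1)⁻¹ • ((z i).2 - 0))) - lag⁻¹ * (W (Φ.flow lag z) - W z))) =
      Real.exp (2 * ((∑ i, gW κ (z i).2) - lag⁻¹ * (W (Φ.flow lag z) - W z))) := by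
    intro z
    simp only [Real.sqrt_one, inv_one, sub_zero, one_smul, one_mul]
  simp_rw [hrw1] at h1
  have h2' : ∫⁻ z, ENNReal.ofReal (Real.exp (4 * h₀'⁻¹ * |W z|)) ∂G ≤ ENNReal.ofReal (Real.exp (δ * (N₀ + 1))) := by
    refine (lintegral_mono fun z => ENNReal.ofReal_le_ofReal (Real.exp_le_exp.2 ?_)).trans h2
    exact mul_le_mul_of_nonneg_right (mul_le_mul_of_nonneg_left (inv_anti₀ hh₀pos hle) (by norm_num))
      (abs_nonneg _)
  have hrig := lagRigidity hσ2 Φ (hprob N₀ Φ) (continuous_gW κ).measurable (abs_gW_le hκ.le) hh₀'pos hlag hWm hW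
    h1 h2'
  have hεeq : 2 * lag / (lag + h₀') = ε₀ := by
    rw [hh₀', hε₀]
    field_simp
    ring
  rw [hεeq, ← hM, ← hΛ] at hrig
  -- `Λ ≤ δ = Λ/2` with `Λ > 0`
  rw [hδ] at hrig
  linarith

end Summit.AtomisticToContinuum.HydrodynamicLimit.Theorems.CorrectorPressureDecayNegative.LagWindow



end
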